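import Mathlib.Analysis.InnerProductSpace.PiL2
import Literature.Analysis.SpecialFunctions.GegenbauerZonalPositivity
import HarnessLib

/-!
# Positive definiteness of the Legendre polynomials on `ℝ³`

The Legendre polynomials `P_k = G_k^{(3)} = C_k^{1/2}` are the zonal spherical functions of
`S² ⊂ ℝ³`; by Schoenberg's theorem (Bachoc–Vallentin 2008, §2 (pos 1); Musin 2008, §3-A) the
kernel `P_k(x · y)` is positive semidefinite on `S²`. We record the homogeneous weighted form
`Σ_{i,j} c_i c_j |p_i|^k |p_j|^k P_k(p_i·p_j / |p_i||p_j|) ≥ 0` for arbitrary vectors `p_i ∈ ℝ³`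
and every degree `k` (`sum_sum_legendreI_nonneg`), in the integer-coefficient normalisation
`legendreI k s q = Σ_j (-1)^j C(k,j) C(2k-2j,k) s^{k-2j} q^j = 2^k |x|^k|y|^k P_k(cos)` at
`s = x·y`, `q = |x|²|y|²`.

The Lean proof is NOT a new positivity argument: `legendreI k s q = 2^k · P^{1/2}_k(2s, q)` for the
bivariate Gegenbauer polynomial `gegenbauerHom` of
`Literature.Analysis.SpecialFunctions.GegenbauerBivariate` (`legendreI_eq_gegenbauerHom`, from
`a_m(1/2) = C(2m,m)/4^m` and `C(2k-2i,k-i) C(k-i,i) = C(k,i) C(2k-2i,k)`), and positivity is the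
case `n = 3`, `μ = 1/2` of
`Literature.Analysis.SpecialFunctions.sum_mul_gegenbauerHom_nonneg` (the addition theorem,
Andrews–Askey–Roy Thm. 9.6.3, proved there through the Fischer pairing).
This is the `S²`-kernel input of the Bachoc–Vallentin matrices `Y_k` (BV 2008, Theorem 3.2).

## References
* C. Bachoc, F. Vallentin, *New upper bounds for kissing numbers from semidefinite programming*,
  J. Amer. Math. Soc. 21 (2008), §2–3. [`BachocVallentin2007`]
* O. R. Musin, *The kissing number in four dimensions*, Ann. of Math. 168 (2008), §3-A/3-B
  (Schoenberg; `G_k^{(3)}` = Legendre). [`Musin2008`]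
* G. E. Andrews, R. Askey, R. Roy, *Special Functions*, CUP 1999, Thm. 9.6.3. [`AndrewsAskeyRoy1999`]
-/

noncomputable section

namespace Literature.Geometry.DiscreteGeometry

open Finset Literature.Analysis.SpecialFunctions

/-- `legendreI k s q = Σ_j (-1)^j C(k,j) C(2k-2j,k) s^{k-2j} q^j = 2^k |x|^k|y|^k P_k(cos)` at
`s = x·y`, `q = |x|²|y|²` (integer-coefficient homogenised Legendre polynomial).
[cite: BachocVallentin2007, §2 (Gegenbauer polynomials, n = 3)] -/
def legendreI (k : ℕ) (s q : ℝ) : ℝ :=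
  ∑ j ∈ Finset.range (k / 2 + 1),
    (-1 : ℝ) ^ j * (k.choose j : ℝ) * ((2 * k - 2 * j).choose k : ℝ) * s ^ (k - 2 * j) * q ^ j

/-- `a_m(1/2) = (1/2)_m / m! = C(2m, m) / 4^m`. [cite: AndrewsAskeyRoy1999, (6.4.11)] -/
theorem gegenbauerA_half (m : ℕ) : gegenbauerA (1 / 2) m = (m.centralBinom : ℝ) / 4 ^ m := by
  induction m with
  | zero => simp [gegenbauerA_zero, Nat.centralBinom_zero]
  | succ m ih =>
    have h := Nat.succ_mul_centralBinom_succ m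
    have hm : (0 : ℝ) < (m : ℝ) + 1 := by positivity
    have h' : (((m + 1).centralBinom : ℕ) : ℝ) = 2 * (2 * m + 1) * m.centralBinom / (m + 1) := by
      rw [eq_div_iff hm.ne']
      have := congrArg (fun n : ℕ => (n : ℝ)) h
      push_cast at this ⊢
      linarith
    rw [gegenbauerA_succ, ih, h']
    field_simp
    ring

/-- The binomial identity `C(2k-2i, k-i) C(k-i, i) = C(k, i) C(2k-2i, k)` (`2i ≤ k`).
[folklore] -/
theorem choose_mul_choose_legendre (k i : ℕ) (h : 2 * i ≤ k) :
    (2 * k - 2 * i).choose (k - i) * (k - i).choose i = k.choose i * (2 * k - 2 * i).choose k := by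
  have h1 : (2 * k - 2 * i).choose (k - i) * (k - i).choose i =
      (2 * k - 2 * i).choose i * (2 * k - 2 * i - i).choose (k - i - i) :=
    Nat.choose_mul (by omega)
  have h2 : (2 * k - 2 * i).choose k * k.choose i =
      (2 * k - 2 * i).choose i * (2 * k - 2 * i - i).choose (k - i) :=
    Nat.choose_mul (by omega)
  have h3 : (2 * k - 2 * i - i).choose (k - i - i) = (2 * k - 2 * i - i).choose (k - i) :=
    Nat.choose_symm_of_eq_add (by omega)
  rw [h1, h3, mul_comm (k.choose i), h2]

/-- `legendreI k s q = 2^k · P^{1/2}_k(2s, q)` (`gegenbauerHom` with `λ = 1/2`, i.e. Legendre).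
[cite: AndrewsAskeyRoy1999, §6.4 (C^{1/2}_k = P_k)] -/
theorem legendreI_eq_gegenbauerHom (k : ℕ) (s q : ℝ) :
    legendreI k s q = 2 ^ k * gegenbauerHom (1 / 2) k (2 * s) q := by
  rw [gegenbauerHom, Finset.Nat.sum_antidiagonal_eq_sum_range_succ
    (fun i m => (gegenbauerA (1 / 2) m * (m.choose i : ℝ)) • ((-q) ^ i * (2 * s) ^ (m - i))),
    Finset.mul_sum, legendreI]
  -- extend the Legendre sum to `range (k+1)` (the extra terms vanish)
  have hsub : Finset.range (k / 2 + 1) ⊆ Finset.range (k + 1) := by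
    apply Finset.range_subset_range.2; omega
  rw [← Finset.sum_subset hsub]
  · refine Finset.sum_congr rfl fun i hi => ?_
    rw [Finset.mem_range] at hi
    have h2 : 2 * i ≤ k := by omega
    rw [smul_eq_mul, gegenbauerA_half]
    have hc : ((2 * k - 2 * i).choose (k - i) : ℝ) * ((k - i).choose i : ℝ) =
        (k.choose i : ℝ) * ((2 * k - 2 * i).choose k : ℝ) := by
      exact_mod_cast choose_mul_choose_legendre k i h2
    have hcb : ((k - i).centralBinom : ℝ) = ((2 * k - 2 * i).choose (k - i) : ℝ) := by
      rw [Nat.centralBinom, show 2 * (k - i) = 2 * k - 2 * i by omega]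
    have hpow : (2 : ℝ) ^ k * (2 : ℝ) ^ (k - i - i) = 4 ^ (k - i) := by
      rw [show (4 : ℝ) = 2 ^ 2 by norm_num, ← pow_mul, ← pow_add]
      congr 1; omega
    have hpow' : (2 : ℝ) ^ k * ((2 : ℝ) ^ (k - i - i) / 4 ^ (k - i)) = 1 := by
      rw [← mul_div_assoc, hpow, div_self (by positivity)]
    have hki : k - i - i = k - 2 * i := by omega
    symm
    calc (2 : ℝ) ^ k * ((k - i).centralBinom / 4 ^ (k - i) * ((k - i).choose i : ℝ) *
          ((-q) ^ i * (2 * s) ^ (k - i - i)))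
        = (2 : ℝ) ^ k * ((2 : ℝ) ^ (k - i - i) / 4 ^ (k - i)) *
            (((2 * k - 2 * i).choose (k - i) : ℝ) * ((k - i).choose i : ℝ)) *
            ((-1) ^ i * s ^ (k - i - i) * q ^ i) := by
            rw [hcb, neg_eq_neg_one_mul, mul_pow, mul_pow]; ring
      _ = (-1) ^ i * (k.choose i : ℝ) * ((2 * k - 2 * i).choose k : ℝ) * s ^ (k - 2 * i) * q ^ i := by
            rw [hpow', hc, hki]; ring
  · intro i hi hi'
    rw [Finset.mem_range] at hi hi'
    have hl : ((k - i).choose i : ℝ) = 0 := by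
      rw [Nat.choose_eq_zero_of_lt (by omega)]; simp
    rw [hl]; simp

/-- **Legendre positivity on `ℝ³`** (Schoenberg / addition theorem, every degree `k`):
`Σ_{i,j} c_i c_j legendreI k (p_i·p_j) (|p_i|²|p_j|²) ≥ 0`. The proof is the case `n = 3`,
`μ = 1/2` of `Literature.Analysis.SpecialFunctions.sum_mul_gegenbauerHom_nonneg`.
[cite: BachocVallentin2007, §2 (pos 1)] -/
theorem sum_sum_legendreI_nonneg (k : ℕ) {ι : Type*} (s : Finset ι) (c : ι → ℝ)
    (p : ι → EuclideanSpace ℝ (Fin 3)) :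
    0 ≤ ∑ i ∈ s, ∑ j ∈ s, c i * c j * legendreI k (inner ℝ (p i) (p j)) (‖p i‖ ^ 2 * ‖p j‖ ^ 2) := by
  have hμ : ((3 : ℕ) : ℝ) = 2 * (1 / 2 : ℝ) + 2 := by norm_num
  have h := sum_mul_gegenbauerHom_nonneg (n := 3) hμ (by norm_num : (0 : ℝ) < 1 / 2) k
    (fun a : s => fun m => p a m) (fun a => c a)
  have hin : ∀ x y : EuclideanSpace ℝ (Fin 3), inner ℝ x y = ∑ m, x m * y m := by
    intro x y; simp [PiLp.inner_apply, mul_comm]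
  have hno : ∀ x : EuclideanSpace ℝ (Fin 3), ‖x‖ ^ 2 = ∑ m, x m ^ 2 := fun x =>
    EuclideanSpace.real_norm_sq_eq x
  have key : ∀ i j, c i * c j * legendreI k (inner ℝ (p i) (p j)) (‖p i‖ ^ 2 * ‖p j‖ ^ 2) =
      2 ^ k * (c i * c j * gegenbauerHom (1 / 2) k (2 * ∑ m, p i m * p j m)
        ((∑ m, p i m ^ 2) * ∑ m, p j m ^ 2)) := by
    intro i j
    rw [legendreI_eq_gegenbauerHom, hin, hno, hno]; ring
  simp_rw [key, ← Finset.mul_sum]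
  refine mul_nonneg (by positivity) ?_
  rw [← Finset.sum_coe_sort s]
  simp_rw [← Finset.sum_coe_sort s (fun j => c _ * c j * _)]
  exact h

end Literature.Geometry.DiscreteGeometry

end
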